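import Summits.RiemannHypothesis.RiemannHypothesis.Theorems.PfPersistenceDialPincer
import HarnessLib

/-!
# PF-persistence cell — THE COMPLETE NEAR-LAG LADDER: rung `m` for every `m ≥ 1`, ceiling `cos(π/(m+1))`

Framing (page 1): mechanism/rigidity campaign; no RH claims.  Every `theorem` below is PROVED (kernel-checked, RH-free,
weight-free: any `Weights`, any window); nothing asserts a premiss for `ζ` at any window.

The tree's ladder (`PfPersistenceNearLagCeiling`, b49f1641583d) types the rungs `m ≤ 4` of the one-signed odd
autocorrelation ceiling `A⁻_u(y) ≤ (c_m + 2φN)‖u‖²` (`y ≥ L/(2m)`; `c_m = 0, 1/2, √2/2, (1+√5)/4`) in closed algebraic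
form and records the rungs `m ≥ 5` (`c_m = cos(π/(m+1))`) as NOT typed.  This file types ALL rungs at once with the
chain weights `ρ_k = sin((k+1)θ)`, `θ = π/(m+1)`: §1–§2 the identity `ρ_{k+1} + ρ_{k-1} = 2cos θ·ρ_k`, `ρ_k > 0`
(`k < m`), `ρ_m = 0`, and the telescoping `Σ_{k<m-1} ((ρ_{k+1}/ρ_k) b_k + (ρ_k/ρ_{k+1}) b_{k+1}) = 2cos θ·Σ_{k<m} b_k`
— the path-graph bound `2Σ x_k x_{k+1} ≤ 2cos(π/(m+1))Σ x_k²` (largest adjacency eigenvalue of `P_m`,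
[cite: Mieghem2010, §6.4.1 eq. (6.10)]) in the form the integral cells need; §3 the continuous chain bound
`2∫_0^{T-y} f f(·+y) ≤ 2cos(π/(m+1))∫_0^T f²` (`0 < y`, `(m-1)y ≤ T ≤ my`; cells of length `y`, the last partial);
§4 rung `m` for EVERY odd profile, `2∫_0^{L/2-y} θ⁻_vθ⁻_v(·+y) ≤ cos(π/(m+1))‖v‖²` once `L/(2m) ≤ y < L/2`; §5 the
ceilings `A⁻_u(y) ≤ (cos(π/(m+1)) + 2φN)‖u‖²` for `θ⁻_u` (`φ`-floor) one-signed on `H`, `1 ≤ m`, `L/(2m) ≤ y ≤ L`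
(`m = 4`: the golden ceiling again); §6 the rung-`m` up-dial law and two-sided pincer (`PfPersistenceDialPincer`,
aebc587eee1a) and their RUNG-FREE forms with `m = ⌈a/log p⌉₊` — valid at every prime power with `0 < log p` reached
by ANY window.  On served windows (`a ≤ 4 log 2`) nothing improves on the golden ceiling (RULING A311 (P4)); the point
is the un-served regime `a → ∞` at a FIXED prime (`m ≈ a/log p → ∞`, margin `τ − cos(π/(m+1))`), the regime of the
dial-line rigidity statement.  NUMBERS for `ζ` at a window are DATA wherever asserted; nothing here asserts them.
-/

set_option linter.dupNamespace false

noncomputable section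

namespace Summit.RiemannHypothesis.RiemannHypothesis.Theorems.PfPersistence

open Real intervalIntegral MeasureTheory Matrix BigOperators Finset

/-! ## §1 The chain weights `sin((k+1)θ)` -/

/-- PROVED (sum-to-product, the chain identity): `sin((x+2)θ) + sin(xθ) = 2cos θ · sin((x+1)θ)`. [folklore] -/
theorem sin_chain (x θ : ℝ) :
    Real.sin ((x + 2) * θ) + Real.sin (x * θ) = 2 * Real.cos θ * Real.sin ((x + 1) * θ) := by
  have h1 : Real.sin ((x + 2) * θ) = Real.sin ((x + 1) * θ + θ) := by congr 1; ring
  have h2 : Real.sin (x * θ) = Real.sin ((x + 1) * θ - θ) := by congr 1; ring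
  rw [h1, h2, Real.sin_add, Real.sin_sub]
  ring

/-- PROVED: `0 < sin((k+1)π/(n+3))` for `k ≤ n + 1` (the argument lies in `(0, π)`). [folklore] -/
theorem sin_chain_pos {n k : ℕ} (hk : k ≤ n + 1) :
    0 < Real.sin (((k:ℝ) + 1) * (π / ((n:ℝ) + 3))) := by
  have hn : (0:ℝ) < (n:ℝ) + 3 := by positivity
  have hk' : (k:ℝ) + 1 < (n:ℝ) + 3 := by have : (k:ℝ) ≤ (n:ℝ) + 1 := (by exact_mod_cast hk); linarith
  refine Real.sin_pos_of_pos_of_lt_pi (by positivity) ?_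
  calc ((k:ℝ) + 1) * (π / ((n:ℝ) + 3)) < ((n:ℝ) + 3) * (π / ((n:ℝ) + 3)) :=
        mul_lt_mul_of_pos_right hk' (div_pos Real.pi_pos hn)
    _ = π := by field_simp

/-- PROVED: the chain closes, `sin((n+3)·π/(n+3)) = 0`. [folklore] -/
theorem sin_chain_end (n : ℕ) : Real.sin (((n:ℝ) + 3) * (π / ((n:ℝ) + 3))) = 0 := by
  have hn : (n:ℝ) + 3 ≠ 0 := by positivity
  rw [show ((n:ℝ) + 3) * (π / ((n:ℝ) + 3)) = π by field_simp]
  exact Real.sin_pi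

/-- PROVED: the first chain weight ratio is `sin 2θ / sin θ = 2cos θ` (`θ = π/(n+3)`). [folklore] -/
theorem sin_chain_ratio_first (n : ℕ) :
    Real.sin ((((0:ℕ):ℝ) + 1 + 1) * (π / ((n:ℝ) + 3))) / Real.sin ((((0:ℕ):ℝ) + 1) * (π / ((n:ℝ) + 3)))
      = 2 * Real.cos (π / ((n:ℝ) + 3)) := by
  have h0 := sin_chain_pos (n := n) (k := 0) (Nat.zero_le _)
  have hc := sin_chain 0 (π / ((n:ℝ) + 3))
  rw [zero_mul, Real.sin_zero, add_zero] at hc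
  rw [div_eq_iff (ne_of_gt h0)]
  push_cast at hc h0 ⊢
  rw [show ((0:ℝ) + 1 + 1) = 0 + 2 by norm_num]
  linarith [hc]

/-- PROVED: an inner chain coefficient is `ρ_{k-1}/ρ_k + ρ_{k+1}/ρ_k = 2cos θ` (`k + 1 ≤ n + 1`). [folklore] -/
theorem sin_chain_ratio_mid {n k : ℕ} (hk : k + 1 ≤ n + 1) :
    Real.sin (((k:ℝ) + 1) * (π / ((n:ℝ) + 3))) / Real.sin (((k:ℝ) + 1 + 1) * (π / ((n:ℝ) + 3)))
      + Real.sin (((k:ℝ) + 1 + 1 + 1) * (π / ((n:ℝ) + 3))) / Real.sin (((k:ℝ) + 1 + 1) * (π / ((n:ℝ) + 3)))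
      = 2 * Real.cos (π / ((n:ℝ) + 3)) := by
  have h1 : 0 < Real.sin (((k:ℝ) + 1 + 1) * (π / ((n:ℝ) + 3))) := by
    have := sin_chain_pos (n := n) (k := k + 1) hk; push_cast at this; exact this
  have hc := sin_chain ((k:ℝ) + 1) (π / ((n:ℝ) + 3))
  rw [← add_div, div_eq_iff (ne_of_gt h1), show ((k:ℝ) + 1 + 1 + 1) = (k:ℝ) + 1 + 2 by ring]
  linarith [hc]

/-- PROVED: the last chain weight ratio is `ρ_n/ρ_{n+1} = 2cos θ` (because `ρ_{n+2} = 0`). [folklore] -/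
theorem sin_chain_ratio_last (n : ℕ) :
    Real.sin (((n:ℝ) + 1) * (π / ((n:ℝ) + 3))) / Real.sin (((n:ℝ) + 1 + 1) * (π / ((n:ℝ) + 3)))
      = 2 * Real.cos (π / ((n:ℝ) + 3)) := by
  have h1 : 0 < Real.sin (((n:ℝ) + 1 + 1) * (π / ((n:ℝ) + 3))) := by
    have := sin_chain_pos (n := n) (k := n + 1) le_rfl; push_cast at this; exact this
  have hc := sin_chain ((n:ℝ) + 1) (π / ((n:ℝ) + 3))
  rw [show ((n:ℝ) + 1 + 2) = (n:ℝ) + 3 by ring, sin_chain_end n, zero_add] at hc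
  rw [div_eq_iff (ne_of_gt h1)]
  linarith [hc]

/-! ## §2 The telescoping of the weighted AM–GM sum (path-graph bound) -/

/-- **PROVED — THE CHAIN SUM** (`θ = π/(n+3)`, `ρ_k = sin((k+1)θ)`, any reals `b_k`): for `j ≤ n`,
`Σ_{k ≤ j} ((ρ_{k+1}/ρ_k) b_k + (ρ_k/ρ_{k+1}) b_{k+1}) = 2cos θ · Σ_{k ≤ j} b_k + (ρ_j/ρ_{j+1}) b_{j+1}`. [folklore] -/
theorem chain_sum_partial (n : ℕ) (b : ℕ → ℝ) :
    ∀ j, j ≤ n →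
      ∑ k ∈ Finset.range (j + 1),
          (Real.sin (((k:ℝ) + 1 + 1) * (π / ((n:ℝ) + 3))) / Real.sin (((k:ℝ) + 1) * (π / ((n:ℝ) + 3))) * b k
            + Real.sin (((k:ℝ) + 1) * (π / ((n:ℝ) + 3))) / Real.sin (((k:ℝ) + 1 + 1) * (π / ((n:ℝ) + 3))) * b (k + 1))
        = 2 * Real.cos (π / ((n:ℝ) + 3)) * ∑ k ∈ Finset.range (j + 1), b k
          + Real.sin (((j:ℝ) + 1) * (π / ((n:ℝ) + 3))) / Real.sin (((j:ℝ) + 1 + 1) * (π / ((n:ℝ) + 3))) * b (j + 1) := by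
  intro j
  induction j with
  | zero =>
    intro _
    rw [Finset.sum_range_one, Finset.sum_range_one]
    have h := sin_chain_ratio_first n
    push_cast at h ⊢
    rw [h]
  | succ j ih =>
    intro hj
    rw [Finset.sum_range_succ, ih (Nat.le_of_succ_le hj), Finset.sum_range_succ _ (j + 1)]
    have hm := sin_chain_ratio_mid (n := n) (k := j) (by omega)
    push_cast
    linear_combination (b (j + 1)) * hm

/-- **PROVED — THE FULL CHAIN SUM = `2cos(π/(n+3))` × THE PLAIN SUM** (`n + 2` cells, `n + 1` links). [folklore] -/
theorem chain_sum_eq (n : ℕ) (b : ℕ → ℝ) :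
    ∑ k ∈ Finset.range (n + 1),
        (Real.sin (((k:ℝ) + 1 + 1) * (π / ((n:ℝ) + 3))) / Real.sin (((k:ℝ) + 1) * (π / ((n:ℝ) + 3))) * b k
          + Real.sin (((k:ℝ) + 1) * (π / ((n:ℝ) + 3))) / Real.sin (((k:ℝ) + 1 + 1) * (π / ((n:ℝ) + 3))) * b (k + 1))
      = 2 * Real.cos (π / ((n:ℝ) + 3)) * ∑ k ∈ Finset.range (n + 2), b k := by
  rw [chain_sum_partial n b n le_rfl, sin_chain_ratio_last n, Finset.sum_range_succ _ (n + 1)]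
  ring

/-! ## §3 The continuous chain bound -/

/-- **PROVED — THE CONTINUOUS CHAIN BOUND:** for continuous `f`, `0 < y` and `(n+1)y ≤ T ≤ (n+2)y`,
`2∫_0^{T-y} f(t)f(t+y)dt ≤ 2cos(π/(n+3)) · ∫_0^T f(t)²dt` (cells `[ky,(k+1)y]`, the last one `[(n+1)y, T]` partial;
weighted AM–GM on each link with the chain weights, then §2). [cite: Mieghem2010, §6.4.1 eq. (6.10)] -/
theorem two_mul_integral_mul_shift_le_cos {f : ℝ → ℝ} (hf : Continuous f) {y T : ℝ} (hy : 0 < y) (n : ℕ)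
    (hT1 : ((n:ℝ) + 1) * y ≤ T) (hT2 : T ≤ ((n:ℝ) + 2) * y) :
    2 * ∫ t in (0:ℝ)..(T - y), f t * f (t + y) ≤ 2 * Real.cos (π / ((n:ℝ) + 3)) * ∫ t in (0:ℝ)..T, f t ^ 2 := by
  set c : ℕ → ℝ := fun k => min ((k:ℝ) * y) T with hc
  set c' : ℕ → ℝ := fun k => min ((k:ℝ) * y) (T - y) with hc'
  have hc0 : c 0 = 0 := by simp [hc]; nlinarith
  have hcN : c (n + 2) = T := by simp [hc]; linarith
  have hc'0 : c' 0 = 0 := by simp [hc']; nlinarith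
  have hc'N : c' (n + 1) = T - y := by simp [hc']; nlinarith
  have hcell : ∀ k, k < n + 1 → c k = (k:ℝ) * y ∧ c' k = (k:ℝ) * y := by
    intro k hk
    have hk' : (k:ℝ) ≤ n := by exact_mod_cast Nat.lt_succ_iff.mp hk
    have h1 : (k:ℝ) * y ≤ T - y := by nlinarith
    exact ⟨min_eq_left (by linarith), min_eq_left h1⟩
  have hshift : ∀ k, c' k + y = c (k + 1) := by
    intro k
    show min ((k:ℝ) * y) (T - y) + y = min (((k + 1 : ℕ):ℝ) * y) T
    rw [← min_add_add_right]
    push_cast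
    congr 1 <;> ring
  have hmono' : ∀ k, c' k ≤ c' (k + 1) := by
    intro k; simp only [hc']; push_cast
    exact min_le_min_right _ (by nlinarith)
  have hle : ∀ k, c' k ≤ c k := fun k => min_le_min_left _ (by linarith)
  have hB : ∑ k ∈ Finset.range (n + 1), ∫ t in (c' k)..(c' (k + 1)), f t * f (t + y)
      = ∫ t in (0:ℝ)..(T - y), f t * f (t + y) := by
    rw [intervalIntegral.sum_integral_adjacent_intervals fun k _ =>
      (Continuous.intervalIntegrable (by fun_prop) _ _), hc'0, hc'N]
  have hF : ∑ k ∈ Finset.range (n + 2), ∫ t in (c k)..(c (k + 1)), f t ^ 2 = ∫ t in (0:ℝ)..T, f t ^ 2 := by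
    rw [intervalIntegral.sum_integral_adjacent_intervals fun k _ =>
      (Continuous.intervalIntegrable (by fun_prop) _ _), hc0, hcN]
  have hlink : ∀ k ∈ Finset.range (n + 1),
      2 * ∫ t in (c' k)..(c' (k + 1)), f t * f (t + y)
        ≤ Real.sin (((k:ℝ) + 1 + 1) * (π / ((n:ℝ) + 3))) / Real.sin (((k:ℝ) + 1) * (π / ((n:ℝ) + 3)))
            * (∫ t in (c k)..(c (k + 1)), f t ^ 2)
          + Real.sin (((k:ℝ) + 1) * (π / ((n:ℝ) + 3))) / Real.sin (((k:ℝ) + 1 + 1) * (π / ((n:ℝ) + 3)))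
            * (∫ t in (c (k + 1))..(c (k + 1 + 1)), f t ^ 2) := by
    intro k hk
    rw [Finset.mem_range] at hk
    have hρ0 : 0 < Real.sin (((k:ℝ) + 1) * (π / ((n:ℝ) + 3))) := sin_chain_pos (by omega)
    have hρ1 : 0 < Real.sin (((k:ℝ) + 1 + 1) * (π / ((n:ℝ) + 3))) := by
      have := sin_chain_pos (n := n) (k := k + 1) (by omega); push_cast at this; exact this
    have hr : 0 ≤ Real.sin (((k:ℝ) + 1 + 1) * (π / ((n:ℝ) + 3))) / Real.sin (((k:ℝ) + 1) * (π / ((n:ℝ) + 3))) :=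
      div_nonneg hρ1.le hρ0.le
    have hrs : Real.sin (((k:ℝ) + 1 + 1) * (π / ((n:ℝ) + 3))) / Real.sin (((k:ℝ) + 1) * (π / ((n:ℝ) + 3)))
        * (Real.sin (((k:ℝ) + 1) * (π / ((n:ℝ) + 3))) / Real.sin (((k:ℝ) + 1 + 1) * (π / ((n:ℝ) + 3)))) = 1 := by
      rw [div_mul_div_comm, div_eq_one_iff_eq (mul_ne_zero (ne_of_gt hρ0) (ne_of_gt hρ1))]
      ring
    have p := two_mul_integral_mul_shift_le hf (hmono' k) y hr hrs
    rw [hshift k, hshift (k + 1)] at p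
    have hsq : ∫ t in (c' k)..(c' (k + 1)), f t ^ 2 ≤ ∫ t in (c k)..(c (k + 1)), f t ^ 2 := by
      have e : c k = c' k := by rw [(hcell k hk).1, (hcell k hk).2]
      rw [e]
      exact integral_sq_mono_interval hf le_rfl (hmono' k) (hle (k + 1))
    have := mul_le_mul_of_nonneg_left hsq hr
    linarith
  have hsum := Finset.sum_le_sum hlink
  rw [← Finset.mul_sum, hB] at hsum
  have hchain := chain_sum_eq n (fun k => ∫ t in (c k)..(c (k + 1)), f t ^ 2)
  beta_reduce at hchain
  rw [hF] at hchain
  linarith [hsum, hchain]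

/-! ## §4 Rung `m` for the odd profile (every `v`) -/

/-- **PROVED — RUNG `m` IN ITS BAND** (`2 ≤ m`, `L/(2m) ≤ y`, `(m-1)y ≤ L/2`): for EVERY `v`,
`2∫_0^{L/2-y} θ⁻_vθ⁻_v(·+y) ≤ cos(π/(m+1))‖v‖²`. [cite: Mieghem2010, §6.4.1 eq. (6.10)] -/
theorem two_mul_shiftCorr_le_cos_band {L : ℝ} (hL : 0 < L) {N : ℕ} (v : Fin N → ℝ) {y : ℝ} (n : ℕ)
    (hy : L / (2 * ((n:ℝ) + 2)) ≤ y) (hy2 : ((n:ℝ) + 1) * y ≤ L / 2) :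
    2 * ∫ t in (0:ℝ)..(L / 2 - y), profileOdd L v t * profileOdd L v (t + y)
      ≤ Real.cos (π / ((n:ℝ) + 3)) * (v ⬝ᵥ v) := by
  have hn2 : (0:ℝ) < (n:ℝ) + 2 := by positivity
  have hy0 : 0 < y := lt_of_lt_of_le (by positivity) hy
  have hT2 : L / 2 ≤ ((n:ℝ) + 2) * y := by
    have := mul_le_mul_of_nonneg_left hy hn2.le
    rw [mul_div_assoc', mul_comm (2:ℝ), ← div_div, mul_div_cancel_left₀ _ (ne_of_gt hn2)] at this
    exact this
  have h := two_mul_integral_mul_shift_le_cos (continuous_profileOdd L v) hy0 n hy2 hT2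
  rw [integral_profileOdd_sq_half hL v] at h
  linarith

/-- **PROVED — RUNG `m`, LAG-ONLY FORM** (`1 ≤ m`, `L/(2m) ≤ y < L/2`): for EVERY `v`,
`2∫_0^{L/2-y} θ⁻_vθ⁻_v(·+y) ≤ cos(π/(m+1))‖v‖²` (apply the band form on the band `m' = ⌈L/(2y)⌉₊ ≤ m` the lag actually
sits in; `cos(π/(m'+1)) ≤ cos(π/(m+1))`). [cite: Mieghem2010, §6.4.1 eq. (6.10)] -/
theorem two_mul_shiftCorr_le_cos {L : ℝ} (hL : 0 < L) {N : ℕ} (v : Fin N → ℝ) {y : ℝ} {m : ℕ} (hm : 1 ≤ m)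
    (hy : L / (2 * (m:ℝ)) ≤ y) (hy2 : y < L / 2) :
    2 * ∫ t in (0:ℝ)..(L / 2 - y), profileOdd L v t * profileOdd L v (t + y)
      ≤ Real.cos (π / ((m:ℝ) + 1)) * (v ⬝ᵥ v) := by
  have hm0 : (0:ℝ) < m := by exact_mod_cast hm
  have hy0 : 0 < y := lt_of_lt_of_le (by positivity) hy
  set x : ℝ := L / (2 * y) with hx
  have hx1 : 1 < x := by rw [hx, lt_div_iff₀ (by positivity)]; linarith
  have hxm : x ≤ m := by
    rw [hx, div_le_iff₀ (by positivity)]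
    have := mul_le_mul_of_nonneg_left hy (by positivity : (0:ℝ) ≤ 2 * m)
    rw [mul_div_cancel₀ _ (by positivity : (2:ℝ) * m ≠ 0)] at this
    linarith
  set m' : ℕ := ⌈x⌉₊ with hm'
  have hxm' : x ≤ (m':ℝ) := Nat.le_ceil x
  have hm'x : (m':ℝ) < x + 1 := Nat.ceil_lt_add_one (by linarith)
  have hm'2 : 2 ≤ m' := by
    have : 1 < m' := by exact_mod_cast (lt_of_lt_of_le hx1 hxm' : (1:ℝ) < (m':ℝ))
    omega
  have hm'm : m' ≤ m := Nat.ceil_le.mpr hxm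
  obtain ⟨n, hn⟩ : ∃ n : ℕ, m' = n + 2 := ⟨m' - 2, by omega⟩
  have hn' : ((n:ℝ) + 2) = (m':ℝ) := by rw [hn]; push_cast; ring
  have hyb : L / (2 * ((n:ℝ) + 2)) ≤ y := by
    rw [hn', div_le_iff₀ (by positivity)]
    have h1 : L / (2 * y) * (2 * y) = L := div_mul_cancel₀ _ (by positivity)
    nlinarith [hxm', h1]
  have hyb2 : ((n:ℝ) + 1) * y ≤ L / 2 := by
    have e : (n:ℝ) + 1 = (m':ℝ) - 1 := by linarith [hn']
    rw [e]
    have h1 : L / (2 * y) * y = L / 2 := by field_simp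
    have h2 : ((m':ℝ) - 1) * y < L / (2 * y) * y := mul_lt_mul_of_pos_right (by linarith) hy0
    linarith [h1, h2]
  have hband := two_mul_shiftCorr_le_cos_band hL v n hyb hyb2
  have hcos : Real.cos (π / ((n:ℝ) + 3)) ≤ Real.cos (π / ((m:ℝ) + 1)) := by
    apply Real.cos_le_cos_of_nonneg_of_le_pi
    · positivity
    · rw [div_le_iff₀ (by positivity)]; nlinarith [Real.pi_pos]
    · have hle : (n:ℝ) + 3 ≤ (m:ℝ) + 1 := by
        have : (m':ℝ) ≤ (m:ℝ) := by exact_mod_cast hm'm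
        linarith [hn']
      exact div_le_div_of_nonneg_left Real.pi_pos.le (by positivity) hle
  have hvv : 0 ≤ v ⬝ᵥ v := dotProduct_self_nonneg_real v
  nlinarith [hband, hcos, hvv]

/-! ## §5 The ceilings at rung `m` -/

/-- PROVED: the rung ceilings are nonnegative, `0 ≤ cos(π/(m+1))` for `1 ≤ m`. [folklore] -/
theorem cos_rung_nonneg {m : ℕ} (hm : 1 ≤ m) : 0 ≤ Real.cos (π / ((m:ℝ) + 1)) := by
  have hm0 : (1:ℝ) ≤ m := by exact_mod_cast hm
  apply Real.cos_nonneg_of_neg_pi_div_two_le_of_le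
  · have : 0 ≤ π / ((m:ℝ) + 1) := by positivity
    linarith [Real.pi_pos]
  · rw [div_le_div_iff_of_pos_left Real.pi_pos (by positivity) (by norm_num)]; linarith

/-- **PROVED — RUNG-`m` CEILING (raw):** `θ⁻_v` one-signed on `H`, `1 ≤ m`, `L/(2m) ≤ y ≤ L` ⇒
`A⁻_v(y) ≤ cos(π/(m+1))‖v‖²`. [folklore] -/
theorem oddAutocorr_le_cos_of_oneSignedOdd {L : ℝ} (hL : 0 < L) {N : ℕ} {v : Fin N → ℝ} (hv : OneSignedOdd L v)
    {m : ℕ} (hm : 1 ≤ m) {y : ℝ} (hy : L / (2 * (m:ℝ)) ≤ y) (hyL : y ≤ L) :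
    oddAutocorr L v y ≤ Real.cos (π / ((m:ℝ) + 1)) * (v ⬝ᵥ v) := by
  have hvv : 0 ≤ v ⬝ᵥ v := dotProduct_self_nonneg_real v
  have hcos := cos_rung_nonneg hm
  by_cases hfar : L / 2 ≤ y
  · have := oddAutocorr_nonpos_of_oneSignedOdd_far hv hfar hyL
    nlinarith
  · push Not at hfar
    rw [oddAutocorr_eq_straddle_add]
    have hy0 : 0 ≤ y := by linarith [lt_of_lt_of_le (show (0:ℝ) < L / (2 * (m:ℝ)) by positivity) hy]
    have h1 := straddle_nonpos_of_oneSignedOdd (y := y) hv hy0 hfar.le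
    have h2 := two_mul_shiftCorr_le_cos hL v hm hy hfar
    linarith

/-- **PROVED — RUNG-`m` CEILING (floored):** `φ`-floor one-signed on `H` (`0 ≤ φ`), `1 ≤ m`, `L/(2m) ≤ y ≤ L` ⇒
`A⁻_u(y) ≤ (cos(π/(m+1)) + 2φN)‖u‖²`. [folklore] -/
theorem oddAutocorr_le_of_floorOneSignedOdd_rung {L φ : ℝ} (hL : 0 < L) (hφ : 0 ≤ φ) {N : ℕ} {u : Fin N → ℝ}
    (h : FloorOneSignedOdd L φ u) {m : ℕ} (hm : 1 ≤ m) {y : ℝ} (hy : L / (2 * (m:ℝ)) ≤ y) (hyL : y ≤ L) :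
    oddAutocorr L u y ≤ (Real.cos (π / ((m:ℝ) + 1)) + 2 * φ * N) * (u ⬝ᵥ u) := by
  have huu : 0 ≤ u ⬝ᵥ u := dotProduct_self_nonneg_real u
  have hcos := cos_rung_nonneg hm
  by_cases hfar : L / 2 ≤ y
  · have := oddAutocorr_le_of_floorOneSignedOdd_far hL hφ h hfar hyL
    nlinarith
  · push Not at hfar
    rw [oddAutocorr_eq_straddle_add]
    have hy0 : 0 ≤ y := by linarith [lt_of_lt_of_le (show (0:ℝ) < L / (2 * (m:ℝ)) by positivity) hy]
    have h1 := straddle_le_of_floorOneSignedOdd hL hφ h hy0 hfar.le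
    have h2 := two_mul_shiftCorr_le_cos hL u hm hy hfar
    linarith

/-! ## §6 What the pincer needs at every window -/

/-- **PROVED — RUNG-`m` UP-DIAL LAW (floored, `a/m ≤ log p`):** one odd test vector `v ≠ 0` with level `≤ ℓ‖v‖²` and
lag correlation `≥ τ‖v‖²`, `τ > cos(π/(m+1)) + 2φN`, rejects every up-dial with
`ℓ − ε₁(Q⁻(w)) < 2(K−1)w(p)(τ − cos(π/(m+1)) − 2φN)` from the floored odd nodal reader. [folklore] -/
theorem rungUpDial_not_mem_floorNodelessOddAt_of_threshold {win : Window} {p : ℕ} (hp : p ∈ primeRange (2 * win.a))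
    {m : ℕ} (hm : 1 ≤ m) (hrung : win.a / m ≤ Real.log p) {K : ℝ} (hK : 1 ≤ K) {w : Weights} (hw : 0 ≤ w p)
    {φ : ℝ} (hφ : 0 ≤ φ) {v : Fin win.N → ℝ} (hv : v ≠ 0) {ℓ τ : ℝ}
    (hℓ : v ⬝ᵥ (oddBlock w win *ᵥ v) ≤ ℓ * (v ⬝ᵥ v)) (hτ : τ * (v ⬝ᵥ v) ≤ oddAutocorr (2 * win.a) v (Real.log p))
    (ht : ℓ - bottomRayleigh (oddBlock w win)
      < 2 * (K - 1) * w p * (τ - Real.cos (π / ((m:ℝ) + 1)) - 2 * φ * win.N)) :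
    datumOf (dial p K w) ∉ floorNodelessOddAt φ win := by
  have hL : 0 < 2 * win.a := by linarith [win.ha]
  have hy : 2 * win.a / (2 * (m:ℝ)) ≤ Real.log p := by
    rw [mul_div_mul_left _ _ (two_ne_zero)]; exact hrung
  refine upDial_not_mem_floorNodelessOddAt_of_ceiling hp hK hw (c := Real.cos (π / ((m:ℝ) + 1)) + 2 * φ * win.N)
    (fun u hu => oddAutocorr_le_of_floorOneSignedOdd_rung hL hφ hu hm hy (log_le_of_mem_primeRange hL.le hp)) ?_
  refine upDial_levelDrop_of_threshold hp hK hw hv hℓ hτ ?_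
  have e : τ - (Real.cos (π / ((m:ℝ) + 1)) + 2 * φ * win.N) = τ - Real.cos (π / ((m:ℝ) + 1)) - 2 * φ * win.N := by
    ring
  rw [e]; exact ht

/-- **PROVED — RUNG-`m` PINCER (`a/m ≤ log p`, odd ceiling `cos(π/(m+1)) + 2φN`).** [folklore] -/
theorem rungDial_mem_Icc_of_mem_floorNodelessEOAt {win : Window} {p : ℕ} (hp : p ∈ primeRange (2 * win.a))
    {m : ℕ} (hm : 1 ≤ m) (hrung : win.a / m ≤ Real.log p) {w : Weights} (hw : 0 < w p) {φ : ℝ} (hφ : 0 ≤ φ)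
    {v : Fin (win.N + 1) → ℝ} (hv : v ≠ 0) {ℓ σ : ℝ} (hℓ : v ⬝ᵥ (evenBlock w win *ᵥ v) ≤ ℓ * (v ⬝ᵥ v))
    (hσ : autocorr (2 * win.a) v (Real.log p) ≤ -σ * (v ⬝ᵥ v)) (hσ' : 2 * φ * (2 * win.N + 1) < σ)
    {v' : Fin win.N → ℝ} (hv' : v' ≠ 0) {ℓ' τ : ℝ} (hℓ' : v' ⬝ᵥ (oddBlock w win *ᵥ v') ≤ ℓ' * (v' ⬝ᵥ v'))
    (hτ : τ * (v' ⬝ᵥ v') ≤ oddAutocorr (2 * win.a) v' (Real.log p))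
    (hτ' : Real.cos (π / ((m:ℝ) + 1)) + 2 * φ * win.N < τ) {K : ℝ}
    (hK : datumOf (dial p K w) ∈ floorNodelessEOAt φ win) :
    1 - (ℓ - bottomRayleigh (evenBlock w win)) / (2 * w p * (σ - 2 * φ * (2 * win.N + 1))) ≤ K ∧
      K ≤ 1 + (ℓ' - bottomRayleigh (oddBlock w win))
        / (2 * w p * (τ - (Real.cos (π / ((m:ℝ) + 1)) + 2 * φ * win.N))) := by
  have hL : 0 < 2 * win.a := by linarith [win.ha]
  have hy : 2 * win.a / (2 * (m:ℝ)) ≤ Real.log p := by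
    rw [mul_div_mul_left _ _ (two_ne_zero)]; exact hrung
  exact dial_mem_Icc_of_mem_floorNodelessEOAt_of_ceiling hp hw hφ
    (fun u hu => oddAutocorr_le_of_floorOneSignedOdd_rung hL hφ hu hm hy (log_le_of_mem_primeRange hL.le hp))
    hv hℓ hσ hσ' hv' hℓ' hτ hτ' hK

/-- PROVED: every `p` with `0 < log p` sits on the rung `m = ⌈a / log p⌉₊ ≥ 1` of every window. [folklore] -/
theorem rung_ceil {win : Window} {p : ℕ} (hlog : 0 < Real.log p) :
    1 ≤ ⌈win.a / Real.log p⌉₊ ∧ win.a / (⌈win.a / Real.log p⌉₊ : ℕ) ≤ Real.log p := by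
  have hx : 0 < win.a / Real.log p := div_pos win.ha hlog
  have h1 : 1 ≤ ⌈win.a / Real.log p⌉₊ := Nat.one_le_iff_ne_zero.mpr (by
    intro h; rw [Nat.ceil_eq_zero] at h; linarith)
  refine ⟨h1, ?_⟩
  have hm0 : (0:ℝ) < (⌈win.a / Real.log p⌉₊ : ℕ) := by exact_mod_cast h1
  rw [div_le_iff₀ hm0]
  have := Nat.le_ceil (win.a / Real.log p)
  rw [div_le_iff₀ hlog] at this
  linarith [this]

/-- **PROVED — THE RUNG-FREE PINCER: every window, every reached prime power with `0 < log p`** (odd ceiling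
`cos(π/(⌈a/log p⌉₊ + 1)) + 2φN`; no served-window or lag hypothesis). [folklore] -/
theorem ceilDial_mem_Icc_of_mem_floorNodelessEOAt {win : Window} {p : ℕ} (hp : p ∈ primeRange (2 * win.a))
    (hlog : 0 < Real.log p) {w : Weights} (hw : 0 < w p) {φ : ℝ} (hφ : 0 ≤ φ)
    {v : Fin (win.N + 1) → ℝ} (hv : v ≠ 0) {ℓ σ : ℝ} (hℓ : v ⬝ᵥ (evenBlock w win *ᵥ v) ≤ ℓ * (v ⬝ᵥ v))
    (hσ : autocorr (2 * win.a) v (Real.log p) ≤ -σ * (v ⬝ᵥ v)) (hσ' : 2 * φ * (2 * win.N + 1) < σ)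
    {v' : Fin win.N → ℝ} (hv' : v' ≠ 0) {ℓ' τ : ℝ} (hℓ' : v' ⬝ᵥ (oddBlock w win *ᵥ v') ≤ ℓ' * (v' ⬝ᵥ v'))
    (hτ : τ * (v' ⬝ᵥ v') ≤ oddAutocorr (2 * win.a) v' (Real.log p))
    (hτ' : Real.cos (π / ((⌈win.a / Real.log p⌉₊ : ℕ) + 1)) + 2 * φ * win.N < τ) {K : ℝ}
    (hK : datumOf (dial p K w) ∈ floorNodelessEOAt φ win) :
    1 - (ℓ - bottomRayleigh (evenBlock w win)) / (2 * w p * (σ - 2 * φ * (2 * win.N + 1))) ≤ K ∧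
      K ≤ 1 + (ℓ' - bottomRayleigh (oddBlock w win))
        / (2 * w p * (τ - (Real.cos (π / ((⌈win.a / Real.log p⌉₊ : ℕ) + 1)) + 2 * φ * win.N))) :=
  rungDial_mem_Icc_of_mem_floorNodelessEOAt hp (rung_ceil hlog).1 (rung_ceil hlog).2 hw hφ hv hℓ hσ hσ' hv' hℓ' hτ
    hτ' hK

/-- **PROVED — `ζ` handle of the rung-free pincer** (`w = zetaWeights`; `0 < zetaWeights p` forces `2 ≤ p`, hence
`0 < log p`; every other premiss is DATA wherever asserted). [folklore] -/
theorem zeta_ceilDial_mem_Icc_of_mem_floorNodelessEOAt {win : Window} {p : ℕ} (hp : p ∈ primeRange (2 * win.a))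
    (hw : 0 < zetaWeights p) {φ : ℝ} (hφ : 0 ≤ φ)
    {v : Fin (win.N + 1) → ℝ} (hv : v ≠ 0) {ℓ σ : ℝ} (hℓ : v ⬝ᵥ (evenBlock zetaWeights win *ᵥ v) ≤ ℓ * (v ⬝ᵥ v))
    (hσ : autocorr (2 * win.a) v (Real.log p) ≤ -σ * (v ⬝ᵥ v)) (hσ' : 2 * φ * (2 * win.N + 1) < σ)
    {v' : Fin win.N → ℝ} (hv' : v' ≠ 0) {ℓ' τ : ℝ} (hℓ' : v' ⬝ᵥ (oddBlock zetaWeights win *ᵥ v') ≤ ℓ' * (v' ⬝ᵥ v'))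
    (hτ : τ * (v' ⬝ᵥ v') ≤ oddAutocorr (2 * win.a) v' (Real.log p))
    (hτ' : Real.cos (π / ((⌈win.a / Real.log p⌉₊ : ℕ) + 1)) + 2 * φ * win.N < τ) {K : ℝ}
    (hK : datumOf (dial p K zetaWeights) ∈ floorNodelessEOAt φ win) :
    1 - (ℓ - bottomRayleigh (evenBlock zetaWeights win)) / (2 * zetaWeights p * (σ - 2 * φ * (2 * win.N + 1))) ≤ K ∧
      K ≤ 1 + (ℓ' - bottomRayleigh (oddBlock zetaWeights win))
        / (2 * zetaWeights p * (τ - (Real.cos (π / ((⌈win.a / Real.log p⌉₊ : ℕ) + 1)) + 2 * φ * win.N))) := by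
  have h2 : (2:ℝ) ≤ p := by exact_mod_cast two_le_of_zetaWeights_pos hw
  have hlog : 0 < Real.log p := Real.log_pos (by linarith)
  exact ceilDial_mem_Icc_of_mem_floorNodelessEOAt hp hlog hw hφ hv hℓ hσ hσ' hv' hℓ' hτ hτ' hK

end Summit.RiemannHypothesis.RiemannHypothesis.Theorems.PfPersistence

end
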